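import Summits.BirchSwinnertonDyer.BirchSwinnertonDyer.Theorems.PrintCf2DisegniPairTwoTameTransport
import Summits.BirchSwinnertonDyer.BirchSwinnertonDyer.Theorems.ThetaPartnerAtTwoSignedMainConjectureCMTwoRankZeroFlatTwistImaginary
import Literature.NumberTheory.EllipticCurves.PAdicLFunctionTameMinusBirchTransformProofs
import HarnessLib

/-!
# Road (C) `disegni-pair-two` on crux stmt-BirchSwinnertonDyer-20368 — BIRCH TRANSPORT on the `2`-adic side for a NEGATIVE
# twist parameter: the branch function of `V = E^{(d)}`, `d < 0`, is `c · (1+T)^{−ℓ} ·` (the TAME `χ_d`-twisted `2`-adic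
# `L`-function of the MINUS measure of the base `E`), with the SAME `c` as in `c²·|d|·(Ω⁺_{f_V})² = (Ω⁻_{f_E})²`

Cell `bsd-print-cf2`, width seat `bsd-line-cf2-p1-w8` g24; the `d < 0` twin of `PrintCf2DisegniPairTwoTameTransport.lean`.
`--supports stmt-BirchSwinnertonDyer-20368` (helper). THEOREMS ONLY (no `def`, no named fact, no `sorry`); conditional on every
displayed hypothesis (modularity `exists_isNewformOf`). BSD is not proved by any of this; no summit statement is claimed; 20368 is not
closed here.

For `d < 0` the twisting character `χ_d = (·/|d|)` is ODD, so Birch's lemma reads the PLUS symbols of `f_V` on the MINUS symbols of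
`f_E` (tree `FlatTwist.Imaginary.exists_ratPlusSymbol_negTwist_eq_sum_and_sq`: ONE `c` with `[x]⁺_{f_V} = c·Σ_b (b/|d|)[x + b/|d|]⁻_{f_E}`
and `c²·|d|·(Ω⁺_{f_V})² = (Ω⁻_{f_E})²`), and the `2`-adic transform is the minus tame function `L⁻₂(f_E, |d|, α_E, χ_d, ·) =
padicLFunctionTameMinus` (`padicLFunction_twist_eq_of_birch_odd`, the minus twin typed and proved for this purpose).

* §1 ★★ `exists_birchConstant_two_neg` — `V` ordinary at `2` and ONE `c ∈ ℚˣ` with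
  `L₂(f_V, α_V, T) = C(c)·(1+T)^{−ℓ_{|d|}}·L⁻₂(f_E, |d|, α_E, χ_d, T)` AND `c²·|d|·(Ω⁺_{f_V})² = (Ω⁻_{f_E})²`.
* §2 ★★ `deriv_padicLFunction_negTwist_eq`, ★★ `valuation_deriv_padicLFunction_negTwist_eq` — branch-point vanishing at
  `T = −2` transports to the minus tame function, `D_V = c·u·D_{G⁻}` (`‖u‖₂ = 1`), `D_V ≠ 0 ↔ D_{G⁻} ≠ 0`,
  `v₂(D_V) = v₂(c) + v₂(D_{G⁻})`.

References: B. Mazur, J. Tate, J. Teitelbaum, Invent. Math. 84 (1986) §I.8, §I.11–I.13 [MazurTateTeitelbaum1986Invent];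
K. Matsuno, J. Number Theory 84 (2000) §2 [Matsuno2000]; V. Pal, Proc. AMS 140 (2012) Thm. 3.2 [Pal2012].
-/

set_option autoImplicit false
set_option linter.dupNamespace false

noncomputable section

open scoped Classical MatrixGroups ModularForm NumberField NumberTheorySymbols

open CongruenceSubgroup NumberField IsDedekindDomain WeierstrassCurve PowerSeries
  Literature.NumberTheory.EllipticCurves Literature.NumberTheory.EllipticCurves.ModularForms
  Literature.NumberTheory.EllipticCurves.GreenbergVatsal2000 Literature.NumberTheory.GaloisRepresentations
  Literature.NumberTheory.EllipticCurves.PadicEval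
  Summit.BirchSwinnertonDyer.BirchSwinnertonDyer.Theorems.FlatTwist.Imaginary

namespace Summit.BirchSwinnertonDyer.BirchSwinnertonDyer.Theorems.PrintCf2.DisegniPairTwo

section TransportNeg

variable (E : WeierstrassCurve ℚ) [E.IsElliptic] [E.IsGloballyMinimal] {d : ℤ} {V : WeierstrassCurve ℚ}
  [V.IsElliptic] [V.IsGloballyMinimal] [NeZero (E.conductorNorm ℤ)] [NeZero (V.conductorNorm ℤ)] [NeZero d.natAbs]
  {fE : CuspForm (Gamma0 (E.conductorNorm ℤ)) 2} {fV : CuspForm (Gamma0 (V.conductorNorm ℤ)) 2}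

/-! ### §1 One Birch constant for both sides at `p = 2`, negative twist -/

/-- ★★ **One Birch constant at `p = 2` for a NEGATIVE twist, carrying BOTH identities.** For a globally minimal base `E/ℚ`
good ordinary at `2`, `d < 0` squarefree with `d ≡ 1 (mod 4)` and `(d, N_E) = 1`, a globally minimal model `V` of `E^{(d)}`
(`C₀ • E^{(d)} = V`) and the newforms `f_E`, `f_V`: `V` is good ordinary at `2`, and there is ONE `c ∈ ℚˣ` with
(i) `L₂(f_V, α_V, T) = C(c)·(1+T)^{−ℓ_m}·L⁻₂(f_E, m, α_E, χ_d, T)` (`m = |d|`, `χ_d = (·/m)` odd, MINUS tame function of `f_E`) and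
(ii) `c²·|d|·(Ω⁺_{f_V})² = (Ω⁻_{f_E})²`. [cite: MazurTateTeitelbaum1986Invent, §I.8 and §I.11–I.13] [cite: Matsuno2000, §2 (p. 84)] -/
theorem exists_birchConstant_two_neg (hmod : exists_isNewformOf) (hd : d < 0) (hd4 : d % 4 = 1) (hsq : Squarefree d)
    (hcop : IsCoprime d (E.conductorNorm ℤ : ℤ)) {C₀ : VariableChange ℚ} (hV : C₀ • E.quadraticTwist (d : ℚ) = V)
    (hfE : IsNewformOf E fE) (hfV : IsNewformOf V fV) (hord : IsOrdinaryAt E 2)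
    {χ : MulChar (ZMod d.natAbs) ℤ} (hχ : ∀ a : ZMod d.natAbs, χ a = J((a.val : ℤ) | d.natAbs)) :
    IsOrdinaryAt V 2 ∧ ∃ c : ℚ, c ≠ 0 ∧
      padicLFunction fV (unitRoot V 2 : ℚ_[2]) =
        PowerSeries.C (c : ℚ_[2]) * PowerSeries.binomialSeries ℚ_[2] (-frobeniusExponent 2 (d.natAbs : ℤ_[2])) *
          padicLFunctionTameMinus fE d.natAbs (unitRoot E 2 : ℚ_[2])
            ((χ.ringHomComp (Int.castRingHom ℚ)).ringHomComp (Rat.castHom ℚ_[2])) ∧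
      (c : ℝ) ^ 2 * (d.natAbs : ℝ) * plusPeriod fV ^ 2 = minusPeriod fE ^ 2 := by
  have hp : (2 : ℕ).Prime := Nat.prime_two
  have hpd : ¬ ((2 : ℕ) : ℤ) ∣ d := by omega
  obtain ⟨c, hB, hper⟩ := exists_ratPlusSymbol_negTwist_eq_sum_and_sq E hmod hd hd4 hsq hcop hV hfE hfV hχ
  obtain ⟨hordV, hαV⟩ := isOrdinaryAt_twist_and_unitRoot_eq E 2 hmod hd4 hsq hcop hV hord hpd
  obtain ⟨hαeq, hαu, -⟩ := unitRoot_coe_spec (W := E) hord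
  have hpN : ¬ 2 ∣ E.conductorNorm ℤ := not_dvd_level_of_isNewformOf hfE hord.1
  have hpm : ¬ 2 ∣ d.natAbs := fun h ↦ hpd (Int.natCast_dvd.mpr h)
  have hmp : d.natAbs.Coprime 2 := Nat.coprime_comm.mp ((Nat.Prime.coprime_iff_not_dvd hp).mpr hpm)
  have hap : cuspCoeff fE 2 = ((E.frobeniusTrace 2 : ℤ) : ℂ) :=
    cuspCoeff_eq_frobeniusTrace_of_isNewformOf_holds hfE hord.1
  have hχp : (χ.ringHomComp (Int.castRingHom ℚ)) ((2 : ℕ) : ZMod d.natAbs) ^ 2 = 1 := by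
    rw [MulChar.ringHomComp_apply, ← map_pow, mulChar_jacobi_apply_natCast_sq hχ 2 hmp.symm, map_one]
  -- the symbol relation with `χ` read in `ℚ`
  have hB' : ∀ x : ℚ, ratPlusSymbol fV x = c * ∑ b : ZMod d.natAbs,
      (χ.ringHomComp (Int.castRingHom ℚ)) b * ratMinusSymbol fE (x + (b.val : ℚ) / d.natAbs) := by
    intro x
    rw [hB x]
    congr 1
    refine Finset.sum_congr rfl fun b _ ↦ ?_
    rw [MulChar.ringHomComp_apply, hχ, eq_intCast]
  have key := padicLFunction_twist_eq_of_birch_odd fE fV hfE.1 hfE.coeffField_eq_bot hpN hmp hap hαeq hαu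
    (χ.ringHomComp (Int.castRingHom ℚ)) hχp hB'
  have hαV' : (unitRoot V 2 : ℚ_[2]) =
      (((χ.ringHomComp (Int.castRingHom ℚ)) ((2 : ℕ) : ZMod d.natAbs) : ℚ) : ℚ_[2]) * (unitRoot E 2 : ℚ_[2]) := by
    rw [hαV, MulChar.ringHomComp_apply, mulChar_jacobi_apply_natCast hχ 2, eq_intCast]
    push_cast
    rfl
  have hxV : ∃ x : ℚ, ratPlusSymbol fV x ≠ 0 := exists_ratPlusSymbol_ne_zero hfV.1 hfV.coeffField_eq_bot
  refine ⟨hordV, c, ?_, by rw [hαV']; exact key, hper hxV⟩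
  rintro rfl
  have h0 := padicLFunction_unitRoot_ne_zero hordV hfV
  rw [hαV', key, Rat.cast_zero, map_zero, zero_mul, zero_mul] at h0
  exact h0 rfl

/-! ### §2 The derivative functional at the conductor-`8` point transports (negative twist) -/

/-- `‖−2‖₂ < 1`. [folklore] -/
private theorem norm_neg_two_lt_one_neg : ‖(-2 : ℚ_[2])‖ < 1 := by
  rw [norm_neg, show (2 : ℚ_[2]) = ((2 : ℕ) : ℚ_[2]) by norm_num, Padic.norm_p]
  norm_num

/-- ★★ **The derivative at the conductor-`8` point transports (negative twist).** In the setting of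
`exists_birchConstant_two_neg`, if `Σ_k [T^k]L₂(f_V, α_V)·(−2)^k = 0` then the minus tame function `G⁻ = L⁻₂(f_E, |d|, α_E, χ_d, ·)`
also vanishes at `−2` and `Σ_k k[T^k]L₂(f_V,α_V)(−2)^{k−1} = c · u · Σ_k k[T^k]G⁻(−2)^{k−1}` with `‖u‖₂ = 1`, for the SAME `c`
as `c²·|d|·(Ω⁺_{f_V})² = (Ω⁻_{f_E})²`. [cite: MazurTateTeitelbaum1986Invent, §I.8 and §I.13] [cite: Matsuno2000, §2 (p. 84)] -/
theorem deriv_padicLFunction_negTwist_eq (hmod : exists_isNewformOf) (hd : d < 0) (hd4 : d % 4 = 1)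
    (hsq : Squarefree d) (hcop : IsCoprime d (E.conductorNorm ℤ : ℤ)) {C₀ : VariableChange ℚ}
    (hV : C₀ • E.quadraticTwist (d : ℚ) = V) (hfE : IsNewformOf E fE) (hfV : IsNewformOf V fV)
    (hord : IsOrdinaryAt E 2) {χ : MulChar (ZMod d.natAbs) ℤ}
    (hχ : ∀ a : ZMod d.natAbs, χ a = J((a.val : ℤ) | d.natAbs))
    (h0 : HasSum (fun k : ℕ ↦ PowerSeries.coeff k (padicLFunction fV (unitRoot V 2 : ℚ_[2])) *
      (-2 : ℚ_[2]) ^ k) 0) :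
    ∃ c : ℚ, c ≠ 0 ∧ (c : ℝ) ^ 2 * (d.natAbs : ℝ) * plusPeriod fV ^ 2 = minusPeriod fE ^ 2 ∧
      HasSum (fun k : ℕ ↦ PowerSeries.coeff k (padicLFunctionTameMinus fE d.natAbs (unitRoot E 2 : ℚ_[2])
        ((χ.ringHomComp (Int.castRingHom ℚ)).ringHomComp (Rat.castHom ℚ_[2]))) * (-2 : ℚ_[2]) ^ k) 0 ∧
      ∃ u : ℚ_[2], ‖u‖ = 1 ∧
        (∑' k : ℕ, PowerSeries.coeff k (padicLFunction fV (unitRoot V 2 : ℚ_[2])) * (k : ℚ_[2]) *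
            (-2) ^ (k - 1)) =
          (c : ℚ_[2]) * u * ∑' k : ℕ, PowerSeries.coeff k (padicLFunctionTameMinus fE d.natAbs (unitRoot E 2 : ℚ_[2])
            ((χ.ringHomComp (Int.castRingHom ℚ)).ringHomComp (Rat.castHom ℚ_[2]))) * (k : ℚ_[2]) *
              (-2) ^ (k - 1) := by
  obtain ⟨hordV, c, hc0, hkey, hper⟩ := exists_birchConstant_two_neg E hmod hd hd4 hsq hcop hV hfE hfV hord hχ
  set L := padicLFunction fV (unitRoot V 2 : ℚ_[2]) with hLdef
  set G := padicLFunctionTameMinus fE d.natAbs (unitRoot E 2 : ℚ_[2])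
    ((χ.ringHomComp (Int.castRingHom ℚ)).ringHomComp (Rat.castHom ℚ_[2])) with hGdef
  set s : ℤ_[2] := frobeniusExponent 2 (d.natAbs : ℤ_[2]) with hsdef
  set P := PowerSeries.binomialSeries ℚ_[2] (-s) with hPdef
  have hc0' : (c : ℚ_[2]) ≠ 0 := by exact_mod_cast hc0
  obtain ⟨BL, hBL⟩ := exists_forall_norm_coeff_padicLFunction_le (f := fV) hordV hfV
  have hBP : ∀ k, ‖PowerSeries.coeff k P‖ ≤ 1 := norm_coeff_binomialSeries_le_one (-s)
  obtain ⟨BG, hBG⟩ := exists_norm_coeff_le_of_eq_C_mul_binomialSeries_mul hc0' s hkey hBL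
  have ha := norm_neg_two_lt_one_neg
  have hevL : ∑' k : ℕ, PowerSeries.coeff k L * (-2 : ℚ_[2]) ^ k = 0 := h0.tsum_eq
  have hevPG : ∑' k : ℕ, PowerSeries.coeff k L * (-2 : ℚ_[2]) ^ k =
      (c : ℚ_[2]) * ((∑' k : ℕ, PowerSeries.coeff k P * (-2 : ℚ_[2]) ^ k) *
        ∑' k : ℕ, PowerSeries.coeff k G * (-2 : ℚ_[2]) ^ k) := by
    rw [hkey, mul_assoc, tsum_eval_C_mul, tsum_coeff_mul hBP hBG ha]
  have hu : ‖∑' k : ℕ, PowerSeries.coeff k P * (-2 : ℚ_[2]) ^ k‖ = 1 := norm_tsum_eval_binomialSeries (-s) ha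
  have hP0 : ∑' k : ℕ, PowerSeries.coeff k P * (-2 : ℚ_[2]) ^ k ≠ 0 := tsum_eval_binomialSeries_ne_zero (-s) ha
  have hevG : ∑' k : ℕ, PowerSeries.coeff k G * (-2 : ℚ_[2]) ^ k = 0 := by
    rw [hevL] at hevPG
    rcases mul_eq_zero.mp hevPG.symm with h | h
    · exact absurd h hc0'
    · rcases mul_eq_zero.mp h with h' | h'
      · exact absurd h' hP0
      · exact h'
  have hGsum : HasSum (fun k : ℕ ↦ PowerSeries.coeff k G * (-2 : ℚ_[2]) ^ k) 0 := by
    rw [← hevG]; exact (summable_of_norm_le hBG ha).hasSum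
  have hD : ∑' k : ℕ, PowerSeries.coeff k L * (k : ℚ_[2]) * (-2) ^ (k - 1) =
      (c : ℚ_[2]) * (∑' k : ℕ, PowerSeries.coeff k P * (-2 : ℚ_[2]) ^ k) *
        ∑' k : ℕ, PowerSeries.coeff k G * (k : ℚ_[2]) * (-2) ^ (k - 1) := by
    rw [hkey, mul_assoc, tsum_deriv_C_mul, tsum_deriv_mul_of_eval_eq_zero hBP hBG ha hevG, mul_assoc]
  exact ⟨c, hc0, hper, hGsum, _, hu, hD⟩

/-- ★★ **Valuation form (negative twist)**: `D_V ≠ 0 ↔ D_{G⁻} ≠ 0` and `v₂(D_V) = v₂(c) + v₂(D_{G⁻})` when non-zero, with the SAME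
`c` as in `c²·|d|·(Ω⁺_{f_V})² = (Ω⁻_{f_E})²`. [cite: MazurTateTeitelbaum1986Invent, §I.8 and §I.13] -/
theorem valuation_deriv_padicLFunction_negTwist_eq (hmod : exists_isNewformOf) (hd : d < 0) (hd4 : d % 4 = 1)
    (hsq : Squarefree d) (hcop : IsCoprime d (E.conductorNorm ℤ : ℤ)) {C₀ : VariableChange ℚ}
    (hV : C₀ • E.quadraticTwist (d : ℚ) = V) (hfE : IsNewformOf E fE) (hfV : IsNewformOf V fV)
    (hord : IsOrdinaryAt E 2) {χ : MulChar (ZMod d.natAbs) ℤ}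
    (hχ : ∀ a : ZMod d.natAbs, χ a = J((a.val : ℤ) | d.natAbs))
    (h0 : HasSum (fun k : ℕ ↦ PowerSeries.coeff k (padicLFunction fV (unitRoot V 2 : ℚ_[2])) *
      (-2 : ℚ_[2]) ^ k) 0) :
    ∃ c : ℚ, c ≠ 0 ∧ (c : ℝ) ^ 2 * (d.natAbs : ℝ) * plusPeriod fV ^ 2 = minusPeriod fE ^ 2 ∧
      HasSum (fun k : ℕ ↦ PowerSeries.coeff k (padicLFunctionTameMinus fE d.natAbs (unitRoot E 2 : ℚ_[2])
        ((χ.ringHomComp (Int.castRingHom ℚ)).ringHomComp (Rat.castHom ℚ_[2]))) * (-2 : ℚ_[2]) ^ k) 0 ∧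
      ((∑' k : ℕ, PowerSeries.coeff k (padicLFunction fV (unitRoot V 2 : ℚ_[2])) * (k : ℚ_[2]) *
            (-2) ^ (k - 1)) ≠ 0 ↔
        (∑' k : ℕ, PowerSeries.coeff k (padicLFunctionTameMinus fE d.natAbs (unitRoot E 2 : ℚ_[2])
            ((χ.ringHomComp (Int.castRingHom ℚ)).ringHomComp (Rat.castHom ℚ_[2]))) * (k : ℚ_[2]) *
              (-2) ^ (k - 1)) ≠ 0) ∧
      ((∑' k : ℕ, PowerSeries.coeff k (padicLFunctionTameMinus fE d.natAbs (unitRoot E 2 : ℚ_[2])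
            ((χ.ringHomComp (Int.castRingHom ℚ)).ringHomComp (Rat.castHom ℚ_[2]))) * (k : ℚ_[2]) *
              (-2) ^ (k - 1)) ≠ 0 →
        (∑' k : ℕ, PowerSeries.coeff k (padicLFunction fV (unitRoot V 2 : ℚ_[2])) * (k : ℚ_[2]) *
            (-2) ^ (k - 1)).valuation =
          padicValRat 2 c + (∑' k : ℕ, PowerSeries.coeff k (padicLFunctionTameMinus fE d.natAbs (unitRoot E 2 : ℚ_[2])
            ((χ.ringHomComp (Int.castRingHom ℚ)).ringHomComp (Rat.castHom ℚ_[2]))) * (k : ℚ_[2]) *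
              (-2) ^ (k - 1)).valuation) := by
  obtain ⟨c, hc0, hper, hGsum, u, hu, hD⟩ :=
    deriv_padicLFunction_negTwist_eq E hmod hd hd4 hsq hcop hV hfE hfV hord hχ h0
  have hc0' : (c : ℚ_[2]) ≠ 0 := by exact_mod_cast hc0
  have hu0 : u ≠ 0 := norm_pos_iff.mp (by rw [hu]; exact one_pos)
  have hvu : u.valuation = 0 := valuation_eq_of_norm_eq hu0 (n := 0) (by rw [hu]; simp)
  refine ⟨c, hc0, hper, hGsum, ?_, fun hG ↦ ?_⟩
  · rw [hD]
    refine ⟨fun h hG ↦ h (by rw [hG, mul_zero]), fun hG ↦ mul_ne_zero (mul_ne_zero hc0' hu0) hG⟩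
  · rw [hD, Padic.valuation_mul (mul_ne_zero hc0' hu0) hG, Padic.valuation_mul hc0' hu0, Padic.valuation_ratCast,
      hvu, add_zero]

end TransportNeg

end Summit.BirchSwinnertonDyer.BirchSwinnertonDyer.Theorems.PrintCf2.DisegniPairTwo

end
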